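import Summits.MatrixMultiplication.MatrixMultiplication.Theorems.AbelianSTPPCensusShapeCertVQSpec
import Summits.MatrixMultiplication.MatrixMultiplication.Theorems.AbelianSTPPCensusShapeCertVPBounds

/-!
# Abelian STPP census — soundness of `ShapeCertVQ` (part 4b: the bounds at a node; soundness of the two node kills)

Cell mm-stpp, rung F-M1; successor kernel item VQ-CERT in support of the closed crux item stmt-MatrixMultiplication-19191; seat
mm-stpp-vp-p2 (gen 1).  Verbatim after theory g6's `…ShapeCertVPBounds` (level floor `loLev` for `27`, order bound `489` for
`337`): for a vQ-admissible family `G` above a prefix `fam` whose tail members have ratio level `≤ L` or `≤ loLev`, the packing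
ratio bound, the first-member bound, the Grynkiewicz budget and continuation bound, the exhausted-budget case, the soundness of
the U11-G kill; the top level (`gsum_le_of_lowQ`: with the zero floor row a family of floor-level members does not beat — in fact
there is none); and NEW: **the E3⁺ node kill is sound** (`AboveQ.false_of_killE`): a prefix member killed with the prefix's
off-member sums is killed in `G` (eng-2 g5's `STPPThreeRoomEnergy.e3pLHS_mono`), contradicting `AdmE M G`.
-/

set_option linter.dupNamespace false -- `MatrixMultiplication.MatrixMultiplication` (summit = problem, D-0017)
set_option autoImplicit false

namespace Summit.MatrixMultiplication.MatrixMultiplication.Theorems.ShapeCertVQ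

open ShapeCert ShapeCertVP STPPThreeRoomEnergy Multiset

section bounds
/-! ### The bounds for an admissible family above a prefix -/

variable {M : ℕ} {G : Multiset (ℕ × ℕ × ℕ)} {fam : List Sh}

/-- the gain of the family splits into prefix and tail -/
theorem AboveQ.gsum_split (h : AboveQ M G fam) : gsumQ G = gs fam + gsumQ (G - famT fam) := by
  unfold gsumQ; rw [gs_eqQ h.wf]; exact sum_map_split h.le _

/-- **packing ratio bound with the level table**: if every tail member has level `≤ L` or `≤ loLev` then
`K·gain(G) ≤ K·gain(fam) + bnd` with eng-2's continuation bound read at `tabRQ L` -/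
theorem AboveQ.gsum_le_bnd (h : AboveQ M G fam) {L : ℕ} (hL : ∀ x ∈ G - famT fam, levTQ x ≤ loLev ∨ levTQ x ≤ L) :
    gsumQ G * K ≤ gs fam * K + (aggOf M fam).bnd M (tabRQ L) := by
  rw [h.gsum_split, Nat.add_mul]
  by_cases hd : (aggOf M fam).dead M = true
  · rw [h.tail_eq_zero_of_dead hd]; simp [gsumQ]
  rw [Agg.bnd, if_neg hd]
  apply Nat.add_le_add_left
  have hq := h.tail_uu
  calc gsumQ (G - famT fam) * K
      = ((G - famT fam).map fun x => gTQ x * K).sum := by unfold gsumQ; rw [Multiset.sum_map_mul_right]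
    _ ≤ ((G - famT fam).map fun x => (tabRQ L).get ((aggOf M fam).kOf M) * uu x).sum := by
        apply Multiset.sum_map_le_sum_map
        intro x hx
        have hU := h.univ x (mem_G_of_tail hx)
        exact (gTQ_mul_le_rho hU).trans (Nat.mul_le_mul_right _
          (rhoTQ_le_tabRQ' h.hM hU (hL x hx) (h.tail_capOK hx)))
    _ = (tabRQ L).get ((aggOf M fam).kOf M) * ((G - famT fam).map uu).sum := by rw [Multiset.sum_map_mul_left]
    _ ≤ (tabRQ L).get ((aggOf M fam).kOf M) * (aggOf M fam).q0 M := Nat.mul_le_mul_left _ hq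

/-- no beating family through a prefix whose table bound closes -/
theorem AboveQ.not_beat_of_R (h : AboveQ M G fam) {L : ℕ} (hL : ∀ x ∈ G - famT fam, levTQ x ≤ loLev ∨ levTQ x ≤ L)
    (hle : gs fam * K + (aggOf M fam).bnd M (tabRQ L) ≤ M * D * K) : ¬ M * D < gsumQ G := by
  have := (h.gsum_le_bnd hL).trans hle
  have := Nat.le_of_mul_le_mul_right this (show 0 < K by decide)
  omega

/-- the `bnd` form of a closing test `g0 + sel (tabRQ L) · q0 ≤ mdk` -/
theorem bnd_le_of_testQ {A : Agg} {M L : ℕ} (h : A.gs * K + selOf (A.kOf M) (tabRQ L) * A.q0 M ≤ M * D * K) :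
    A.gs * K + A.bnd M (tabRQ L) ≤ M * D * K := by
  unfold Agg.bnd; split_ifs
  · simpa using (Nat.le_add_right _ _).trans h
  · rw [selOf_eq] at h; exact h

/-- **first-member bound**: with the candidate `t` a tail member of level `L`, all other tail members of level `≤ L`
or `≤ loLev`, the gain of `G` is at most prefix + `t` + `tabRQ L (kOf) · min(q0, (3M + a+b+c)/2 − uu(fam) − uu(t))` -/
theorem AboveQ.not_beat_of_first (h : AboveQ M G fam) {t : Sh} (ht : t.tr ∈ G - famT fam) (hwt : t = shQ M t.tr)
    (hL : ∀ x ∈ G - famT fam, levTQ x ≤ loLev ∨ levTQ x ≤ t.lev)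
    (hle : gs fam * K + t.g * K + selOf ((aggOf M fam).kOf M) (tabRQ t.lev) *
      min ((aggOf M fam).q0 M) ((3 * M + (t.a + t.b + t.c)) / 2 - uuA (aggOf M fam) - (t.ab + t.bc + t.ca)) ≤ M * D * K) :
    ¬ M * D < gsumQ G := by
  intro hbeat
  -- split the family: prefix, the member `t`, the rest
  have hle1 : famT (t :: fam) ≤ G := cons_le_of_mem_sub h.le ht
  have hwf1 : WfQ M (t :: fam) := by
    intro s hs; rcases List.mem_cons.mp hs with rfl | hs
    · exact hwt
    · exact h.wf s hs
  have h1 : AboveQ M G (t :: fam) := ⟨h.hM, h.univ, h.adm, h.admG, h.admE, hwf1, hle1⟩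
  have hsplit := h1.gsum_split
  have hgs : gs (t :: fam) = t.g + gs fam := rfl
  have hsub : G - famT (t :: fam) ≤ G - famT fam := sub_cons_le _ _ _
  -- the rest's gain against its packing weight
  have hB : ∀ x ∈ G - famT (t :: fam), gTQ x * K ≤ selOf ((aggOf M fam).kOf M) (tabRQ t.lev) * uu x := by
    intro x hx
    have hx' : x ∈ G - famT fam := Multiset.mem_of_le hsub hx
    have hU := h.univ x (mem_G_of_tail hx')
    rw [selOf_eq]
    exact (gTQ_mul_le_rho hU).trans (Nat.mul_le_mul_right _ (rhoTQ_le_tabRQ' h.hM hU (hL x hx') (h.tail_capOK hx')))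
  have hgT : gsumQ (G - famT (t :: fam)) * K ≤
      selOf ((aggOf M fam).kOf M) (tabRQ t.lev) * ((G - famT (t :: fam)).map uu).sum := by
    unfold gsumQ; rw [← Multiset.sum_map_mul_right, ← Multiset.sum_map_mul_left]
    exact Multiset.sum_map_le_sum_map _ _ hB
  -- the rest's packing weight: eng-2's budget and rule U11 at `t`
  have hq1 : ((G - famT (t :: fam)).map uu).sum ≤ (aggOf M fam).q0 M := (sum_map_le_of_le hsub uu).trans h.tail_uu
  have hq2 : ((G - famT (t :: fam)).map uu).sum ≤
      (3 * M + (t.a + t.b + t.c)) / 2 - uuA (aggOf M fam) - (t.ab + t.bc + t.ca) := by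
    have h2 := two_sum_uu_le h.adm (mem_G_of_tail ht)
    rw [sum_map_split hle1 uu] at h2
    have ef : ((famT (t :: fam)).map uu).sum = uu t.tr + ((famT fam).map uu).sum := by
      rw [famT_cons]; simp
    rw [ef, ← uuA_aggOfQ h.wf] at h2
    have e1 : t.a = t.tr.1 := rfl
    have e2 : t.b = t.tr.2.1 := rfl
    have e3 : t.c = t.tr.2.2 := rfl
    have e4 : t.ab + t.bc + t.ca = uu t.tr := by
      rw [hwt]; simp [uu]
    have h3 : uu t.tr + uuA (aggOf M fam) + ((G - famT (t :: fam)).map uu).sum ≤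
        (3 * M + (t.tr.1 + t.tr.2.1 + t.tr.2.2)) / 2 := by
      rw [Nat.le_div_iff_mul_le (by norm_num)]; omega
    rw [e1, e2, e3, e4]; omega
  have hq : ((G - famT (t :: fam)).map uu).sum ≤
      min ((aggOf M fam).q0 M) ((3 * M + (t.a + t.b + t.c)) / 2 - uuA (aggOf M fam) - (t.ab + t.bc + t.ca)) :=
    le_min hq1 hq2
  have : gsumQ G * K ≤ M * D * K := by
    rw [hsplit, hgs]
    calc (t.g + gs fam + gsumQ (G - famT (t :: fam))) * K
        = gs fam * K + t.g * K + gsumQ (G - famT (t :: fam)) * K := by ring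
      _ ≤ gs fam * K + t.g * K + selOf ((aggOf M fam).kOf M) (tabRQ t.lev) *
          min ((aggOf M fam).q0 M) ((3 * M + (t.a + t.b + t.c)) / 2 - uuA (aggOf M fam) - (t.ab + t.bc + t.ca)) :=
          Nat.add_le_add_left (hgT.trans (Nat.mul_le_mul_left _ hq)) _
      _ ≤ M * D * K := hle
  have := Nat.le_of_mul_le_mul_right this (show 0 < K by decide)
  omega

/-- **the Grynkiewicz budget**: for `(r, t)` admissible for the prefix, the tail weights fit the budget -/
theorem AboveQ.wh_sum_le (h : AboveQ M G fam) {r t : ℕ} (hrt : admRT r t (aggOf M fam) fam = true) :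
    ((G - famT fam).map fun x => whT x t).sum ≤
      t * M + 2 * (t * t) - 1 + crS r t fam - t * uuA (aggOf M fam) := by
  obtain ⟨h3, hp1, hp2, hfib⟩ := admRT_specQ h.wf hrt
  have hG := h.admG r t h3 (hp1.trans (sum_map_le_of_le h.le _)) (hp2.trans (sum_map_le_of_le h.le _))
    (hfib.trans (sum_map_le_of_le h.le _))
  rw [sum_map_split h.le uu, sum_map_split h.le (crT r t)] at hG
  have hwc : ((G - famT fam).map fun x => whT x t).sum + ((G - famT fam).map (crT r t)).sum ≤
      t * ((G - famT fam).map uu).sum := by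
    rw [← Multiset.sum_map_add, ← Multiset.sum_map_mul_left]
    exact Multiset.sum_map_le_sum_map _ _ fun x _ => whT_add_crT_le r t x
  rw [crS_eqQ h.wf, uuA_aggOfQ h.wf]
  have e : t * (((famT fam).map uu).sum + ((G - famT fam).map uu).sum) =
      t * ((famT fam).map uu).sum + t * ((G - famT fam).map uu).sum := by ring
  rw [e] at hG
  have h9 : 9 ≤ t * t := Nat.mul_le_mul h3 h3
  omega

/-- a budget of at most `2t` leaves no room for a tail member -/
theorem AboveQ.tail_eq_zero_of_bud (h : AboveQ M G fam) {r t : ℕ} (hrt : admRT r t (aggOf M fam) fam = true)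
    (hb : t * M + 2 * (t * t) - 1 + crS r t fam - t * uuA (aggOf M fam) ≤ 2 * t) : G - famT fam = 0 := by
  rcases Multiset.empty_or_exists_mem (G - famT fam) with h0 | ⟨x, hx⟩
  · exact h0
  exfalso
  have h3 := (admRT_specQ h.wf hrt).1
  obtain ⟨p1, p2, p3⟩ := (h.univ x (mem_G_of_tail hx)).pos
  have hw := whT_ge (by omega : 2 ≤ t) p1 p2 p3
  have hle : whT x t ≤ ((G - famT fam).map fun x => whT x t).sum :=
    Multiset.le_sum_of_mem (Multiset.mem_map_of_mem (fun x => whT x t) hx)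
  have := h.wh_sum_le hrt
  omega

/-- **Grynkiewicz continuation bound with the level table** -/
theorem AboveQ.gsum_le_G (h : AboveQ M G fam) {r i : ℕ} (hrt : admRT r (tOf i) (aggOf M fam) fam = true)
    {L : ℕ} (hL : ∀ x ∈ G - famT fam, levTQ x ≤ loLev ∨ levTQ x ≤ L) :
    gsumQ G * K ≤ gs fam * K +
      (tOf i * M + 2 * (tOf i * tOf i) - 1 + crS r (tOf i) fam - tOf i * uuA (aggOf M fam)) * (tabGQ L).get i := by
  rw [h.gsum_split, Nat.add_mul]
  apply Nat.add_le_add_left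
  have h3 := (admRT_specQ h.wf hrt).1
  calc gsumQ (G - famT fam) * K
      = ((G - famT fam).map fun x => gTQ x * K).sum := by unfold gsumQ; rw [Multiset.sum_map_mul_right]
    _ ≤ ((G - famT fam).map fun x => (tabGQ L).get i * whT x (tOf i)).sum := by
        apply Multiset.sum_map_le_sum_map
        intro x hx
        have hU := h.univ x (mem_G_of_tail hx)
        obtain ⟨p1, p2, p3⟩ := hU.pos
        have hw := whT_ge (by omega : 2 ≤ tOf i) p1 p2 p3
        exact (gTQ_mul_le_qh (by omega)).trans (Nat.mul_le_mul_right _ (qhTQ_le_tabGQ' h.hM hU (hL x hx) i))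
    _ = (tabGQ L).get i * ((G - famT fam).map fun x => whT x (tOf i)).sum := by rw [Multiset.sum_map_mul_left]
    _ ≤ (tabGQ L).get i *
          (tOf i * M + 2 * (tOf i * tOf i) - 1 + crS r (tOf i) fam - tOf i * uuA (aggOf M fam)) :=
        Nat.mul_le_mul_left _ (h.wh_sum_le hrt)
    _ = _ := Nat.mul_comm _ _

/-- no beating family through a prefix whose Grynkiewicz bound closes (budget index `i` with budget `b`) -/
theorem AboveQ.not_beat_of_G (h : AboveQ M G fam) {i b : ℕ} (hb : (budsOf M (aggOf M fam) fam).get i = some b)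
    {L : ℕ} (hL : ∀ x ∈ G - famT fam, levTQ x ≤ loLev ∨ levTQ x ≤ L)
    (hle : gs fam * K + b * (tabGQ L).get i ≤ M * D * K) : ¬ M * D < gsumQ G := by
  rw [budsOf_get] at hb
  obtain ⟨r, hrt, rfl⟩ := budT_some hb
  have := (h.gsum_le_G hrt hL).trans hle
  have := Nat.le_of_mul_le_mul_right this (show 0 < K by decide)
  omega

/-- no beating family through a prefix with an exhausted budget (and non-beating prefix gain) -/
theorem AboveQ.not_beat_of_empty (h : AboveQ M G fam) {i b : ℕ} (hb : (budsOf M (aggOf M fam) fam).get i = some b)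
    (hsmall : b ≤ 2 * tOf i) (hgs : gs fam ≤ M * D) : ¬ M * D < gsumQ G := by
  rw [budsOf_get] at hb
  obtain ⟨r, hrt, rfl⟩ := budT_some hb
  have h0 := h.tail_eq_zero_of_bud hrt hsmall
  rw [h.gsum_split, h0]; simp [gsumQ]; omega

/-- **the kill is sound**: a kill at `(r, t)` refutes rule U11-G (credit form) for the prefix -/
theorem not_admG_of_killAtQ {r t : ℕ} (hw : WfQ M fam) (h : killAt M r t (aggOf M fam) fam = true) :
    ¬ AdmG M (famT fam) := by
  intro hA
  unfold killAt at h
  rw [Bool.and_eq_true, decide_eq_true_eq] at h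
  obtain ⟨h3, hp1, hp2, hfib⟩ := admRT_specQ hw h.1
  have := hA r t h3 hp1 hp2 hfib
  have h9 : 9 ≤ t * t := Nat.mul_le_mul h3 h3
  rw [crS_eqQ hw, uuA_aggOfQ hw] at h
  omega

/-- the kill test of a form refutes rule U11-G for the prefix -/
theorem not_admG_of_killFormQ {r : ℕ} (hw : WfQ M fam) (h : killForm M r (aggOf M fam) fam = true) :
    ¬ AdmG M (famT fam) := by
  unfold killForm at h
  simp only [seqN_eq, Bool.or_eq_true] at h
  rcases h with ((h | h) | h) | h <;> exact not_admG_of_killAtQ hw h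

/-- the kill test refutes rule U11-G for the prefix -/
theorem not_admG_of_killVQ (hw : WfQ M fam) (h : killV M (aggOf M fam) fam = true) : ¬ AdmG M (famT fam) := by
  unfold killV at h
  simp only [seqN_eq, Bool.and_eq_true, Bool.or_eq_true] at h
  rcases h.2 with (h' | h') | h' <;> exact not_admG_of_killFormQ hw h'


/-! ### The E3⁺ node kill is sound -/

/-- the off-member sum of a prefix member: `Σ_{fam} f − f x = Σ_{fam ∖ x} f` -/
theorem erase_sum_eq {F : Multiset (ℕ × ℕ × ℕ)} {x : ℕ × ℕ × ℕ} (hx : x ∈ F) (f : ℕ × ℕ × ℕ → ℕ) :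
    (F.map f).sum - f x = ((F.erase x).map f).sum := by
  have e := congrArg (fun s : Multiset (ℕ × ℕ × ℕ) => (s.map f).sum) (Multiset.cons_erase hx)
  simp only [Multiset.map_cons, Multiset.sum_cons] at e
  omega

/-- **the E3⁺ kill of one member is sound**: a prefix member `t` killed with the prefix's off-member sums refutes `AdmE M G` for
every family `G` above the prefix (the sums only grow, `e3pLHS` is monotone in them) -/
theorem AboveQ.false_of_e3pKillT (h : AboveQ M G fam) {t : Sh} (ht : t ∈ fam) (hk : e3pKillT M (aggOf M fam) t = true) :
    False := by
  unfold e3pKillT at hk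
  simp only [seqN_eq, Bool.and_eq_true, decide_eq_true_eq] at hk
  obtain ⟨h2, hlt⟩ := hk
  have wt := h.wf t ht
  have hxF : t.tr ∈ famT fam := tr_mem_famT ht
  have hxG : t.tr ∈ G := h.mem_G ht
  obtain ⟨p1, p2, p3, hV⟩ := InUniv.sides_vol (h.univ _ hxG)
  have ea := congrArg Sh.a wt; have eb := congrArg Sh.b wt; have ec := congrArg Sh.c wt; have ev := congrArg Sh.V wt
  have eab := congrArg Sh.ab wt; have ebc := congrArg Sh.bc wt; have eca := congrArg Sh.ca wt
  rw [shQ_a] at ea; rw [shQ_b] at eb; rw [shQ_c] at ec; rw [shQ_V] at ev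
  rw [shQ_ab] at eab; rw [shQ_bc] at ebc; rw [shQ_ca] at eca
  have sA : (aggOf M fam).sbc - t.bc = (((famT fam).erase t.tr).map pbc).sum := by
    show sbc fam - t.bc = _; rw [sbc_eqQ h.wf, ebc]; exact erase_sum_eq hxF pbc
  have sB : (aggOf M fam).sca - t.ca = (((famT fam).erase t.tr).map pca).sum := by
    show sca fam - t.ca = _; rw [sca_eqQ h.wf, eca]; exact erase_sum_eq hxF pca
  have sC : (aggOf M fam).sab - t.ab = (((famT fam).erase t.tr).map pab).sum := by
    show sab fam - t.ab = _; rw [sab_eqQ h.wf, eab]; exact erase_sum_eq hxF pab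
  rw [sA, sB, sC, ea, eb, ec, ev] at hlt
  rw [ev] at h2
  have hm := e3pLHS_mono (M := M) p1 p2 p3 hV (erase_sum_le h.le t.tr pbc) (erase_sum_le h.le t.tr pca)
    (erase_sum_le h.le t.tr pab)
  have hadm := h.admE t.tr hxG h2
  rw [sq] at hadm
  unfold vol at hlt hadm hm
  omega

/-- **the E3⁺ node kill is sound**: a killed prefix has no vQ-admissible family above it -/
theorem AboveQ.false_of_killE (h : AboveQ M G fam) (hk : killE M (aggOf M fam) fam = true) : False := by
  unfold killE at hk
  obtain ⟨t, ht, hkt⟩ := List.any_eq_true.mp hk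
  exact h.false_of_e3pKillT ht hkt

/-- **top level**: a family inside the universe satisfying rule U11, all of whose members have ratio level `≤ loLev`,
does not beat (the floor row of the table is zero) -/
theorem gsum_le_of_lowQ (hM : M ≤ 489) (hU : ∀ x ∈ G, InUniv M x) (hA : AdmM M G) (hlow : ∀ x ∈ G, levTQ x ≤ loLev) :
    ¬ M * D < gsumQ G := by
  rcases Multiset.empty_or_exists_mem G with h0 | ⟨t, ht⟩
  · subst h0; simp [gsumQ]
  intro hbeat
  have h2 := two_sum_uu_le hA ht
  have hs : t.1 + t.2.1 + t.2.2 ≤ 3 * (M / 2) := by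
    have hx := hU t ht
    have hv := hx.vol_le
    obtain ⟨p1, p2, p3⟩ := hx.pos
    have ha : t.1 ≤ vol t := by
      unfold vol; calc t.1 = t.1 * 1 * 1 := by ring
        _ ≤ t.1 * t.2.1 * t.2.2 := Nat.mul_le_mul (Nat.mul_le_mul_left _ p2) p3
    have hb : t.2.1 ≤ vol t := by
      unfold vol; calc t.2.1 = 1 * t.2.1 * 1 := by ring
        _ ≤ t.1 * t.2.1 * t.2.2 := Nat.mul_le_mul (Nat.mul_le_mul_right _ p1) p3
    have hc : t.2.2 ≤ vol t := by
      unfold vol; calc t.2.2 = 1 * 1 * t.2.2 := by ring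
        _ ≤ t.1 * t.2.1 * t.2.2 := Nat.mul_le_mul_right _ (Nat.mul_le_mul p1 p2)
    have m1 := le_max_left t.1 (max t.2.1 t.2.2)
    have m2 := (le_max_left t.2.1 t.2.2).trans (le_max_right t.1 (max t.2.1 t.2.2))
    have m3 := (le_max_right t.2.1 t.2.2).trans (le_max_right t.1 (max t.2.1 t.2.2))
    have : t.1 ≤ M / 2 := by rw [Nat.le_div_iff_mul_le (by norm_num)]; omega
    have : t.2.1 ≤ M / 2 := by rw [Nat.le_div_iff_mul_le (by norm_num)]; omega
    have : t.2.2 ≤ M / 2 := by rw [Nat.le_div_iff_mul_le (by norm_num)]; omega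
    omega
  have hq : (G.map uu).sum ≤ (3 * M + 3 * (M / 2)) / 2 := by
    rw [Nat.le_div_iff_mul_le (by norm_num)]; omega
  have hR : gsumQ G * K ≤ (tabRQ loLev).get 7 * (G.map uu).sum := by
    unfold gsumQ; rw [← Multiset.sum_map_mul_right, ← Multiset.sum_map_mul_left]
    apply Multiset.sum_map_le_sum_map
    intro x hx
    have hU' := hU x hx
    exact (gTQ_mul_le_rho hU').trans
      (Nat.mul_le_mul_right _ (rhoTQ_le_tabRQ hM hU' (hlow x hx) (capOK_seven_le le_rfl)))
  have := (hR.trans (Nat.mul_le_mul_left _ hq)).trans (low_numQ M hM)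
  have := Nat.le_of_mul_le_mul_right this (show 0 < K by decide)
  omega

end bounds

end Summit.MatrixMultiplication.MatrixMultiplication.Theorems.ShapeCertVQ
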